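import Summits.RiemannHypothesis.RiemannHypothesis.Theorems.SignConeSignConeOscillatoryStubExtremalExistsLsc
import Summits.RiemannHypothesis.RiemannHypothesis.Theorems.SignConeSignConeDualityStubMultipliers
import Summits.RiemannHypothesis.RiemannHypothesis.Theorems.SignConeSignConeDualityStubSlater
import Summits.RiemannHypothesis.RiemannHypothesis.Theorems.SignConeSignConeDualityStubFarNode
import Summits.RiemannHypothesis.RiemannHypothesis.Theorems.SignConeSignConeDualityStubScaling
import Literature.Analysis.Fourier.BoasKacSmooth
import Literature.NumberTheory.LFunctions.WeilSemilocalCompactnessProofs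
import Literature.NumberTheory.LFunctions.WeilExplicitContinuous

/-!
# Stub `stub_extremalExists` (line `dual_witness`, crux `SignConeOscillatory`, stmt-RiemannHypothesis-16302), IV:
# the sign-cone value and a convergent minimising sequence

At cutoff `a > 0` let `m(a) = inf { reWar (g ⋆ g̃) + 1 : g Weil test, tsupport g ⊆ [-a,a], ∫|g|² = 1,
g ⋆ g̃ node-nonnegative }` (`valueSet a`; nonempty by the Slater bump of `SignConeDuality.stub_slater`, bounded
below by the tree's `bddBelow_weilQuadratic_sphere_holds` because the prime term of a node-nonnegative kernel is
`≥ 0`).  By the Boas–Kac factorisation for smooth data every node-nonnegative family kernel `F = Σᵢ gᵢ ⋆ g̃ᵢ` is a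
single `f ⋆ f̃`, so `m(a) · Re F(0) ≤ reWar F + Re F(0)` on the whole sign cone (`key_ineq`).  A minimising sequence
has bounded Weil-form values, so by the compactness of the form embedding
(`ConnesConsaniMoscovici2025_thm_3_6_holds`) a subsequence converges in `L²` to some `u` supported in `[-a, a]`
(`exists_minimising_limit`).  Part V (`…StubExtremalExists.lean`) reads off the KKT configuration.
-/

noncomputable section

-- `Summit.RiemannHypothesis.RiemannHypothesis.…` repeats a namespace component by design (D-0017 layout).
set_option linter.dupNamespace false

open scoped BigOperators ComplexConjugate Topology
open MeasureTheory Set Filter Complex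

namespace Summit.RiemannHypothesis.RiemannHypothesis.Theorems.SignCone.DualWitness

open Literature.NumberTheory.LFunctions
open Summit.RiemannHypothesis.RiemannHypothesis.Theorems.SignConeDuality

variable {a : ℝ}

/-! ## The prime term of a node-nonnegative kernel is nonnegative -/

/-- For a Weil test `g` on the window with `g ⋆ g̃` node-nonnegative, `Re weilPrimeTerm (g ⋆ g̃) ≥ 0`
(finite sum of `Λ(n) n^{-1/2} · 2 Re G(log n)`, hermitian symmetry `G(-t) = conj G(t)`). [folklore] -/
theorem weilPrimeTerm_re_nonneg {g : ℝ → ℂ} (hg : IsWeilTest g) (hsupp : tsupport g ⊆ Icc (-a) a)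
    (hnodes : ∀ n : ℕ, 2 ≤ n → 0 ≤ (weilConv g (weilReflect g) (Real.log n)).re) :
    0 ≤ (weilPrimeTerm (weilConv g (weilReflect g))).re := by
  set G := weilConv g (weilReflect g) with hG
  have hfar : ∀ u : ℝ, 2 * a < |u| → G u = 0 := by
    intro u hu
    rcases le_or_gt 0 u with h0 | h0
    · exact stub_farNode a g hg hsupp u (by rw [abs_of_nonneg h0] at hu; exact hu.le)
    · have h1 : G (-u) = 0 := stub_farNode a g hg hsupp (-u) (by rw [abs_of_neg h0] at hu; exact hu.le)
      have h2 := conj_weilConv_weilReflect_neg g u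
      rw [← hG] at h2
      rw [← h2, h1, map_zero]
  rw [WeilContinuous.weilPrimeTerm_eq_sum_of_support hfar, Complex.re_sum]
  refine Finset.sum_nonneg fun n _ => ?_
  have hre : (G (Real.log n) + G (-Real.log n)).re = 2 * (G (Real.log n)).re := by
    have hsym : G (-Real.log n) = conj (G (Real.log n)) := by
      rw [hG, ← conj_weilConv_weilReflect_neg g (Real.log n), Complex.conj_conj]
    rw [add_re, hsym, conj_re]; ring
  have hcoef : (((ArithmeticFunction.vonMangoldt n : ℝ) : ℂ) / (Real.sqrt n : ℂ)) =
      ((ArithmeticFunction.vonMangoldt n / Real.sqrt n : ℝ) : ℂ) := by push_cast; rfl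
  rw [hcoef, re_ofReal_mul, hre]
  rcases Nat.lt_or_ge n 2 with hn | hn
  · interval_cases n
    · simp
    · simp [ArithmeticFunction.vonMangoldt_apply_one]
  · exact mul_nonneg (div_nonneg ArithmeticFunction.vonMangoldt_nonneg (Real.sqrt_nonneg _))
      (mul_nonneg zero_le_two (hnodes n hn))

/-- Hence `Re Q(g) ≤ reWar (g ⋆ g̃)` for node-nonnegative kernels on the window. [folklore] -/
theorem weilQuadratic_re_le_reWar {g : ℝ → ℂ} (hg : IsWeilTest g) (hsupp : tsupport g ⊆ Icc (-a) a)
    (hnodes : ∀ n : ℕ, 2 ≤ n → 0 ≤ (weilConv g (weilReflect g) (Real.log n)).re) :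
    (weilQuadratic g).re ≤ reWar (autocorr g) := by
  rw [reWar_eq, autocorr_eq_weilConv]
  simp only [weilQuadratic, weilFunctional, add_re, sub_re]
  linarith [weilPrimeTerm_re_nonneg hg hsupp hnodes]

/-! ## Scaling, the zero kernel -/

/-- `reWar 0 = 0`. [folklore] -/
theorem reWar_zero : reWar (0 : ℝ → ℂ) = 0 := by
  rw [reWar_eq]
  simp [weilPolarTerm, weilArchTerm, weilArchIntegral, weilMellin]

/-- `autocorr 0 = 0`. [folklore] -/
theorem autocorr_zero : autocorr (0 : ℝ → ℂ) = 0 := by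
  unfold autocorr; simp

/-- `reWar (r · F) = r · reWar F` for real `r` (homogeneity of the prime-free Weil form,
`SignConeDuality.stub_scaling`). [folklore] -/
theorem reWar_const_mul (r : ℝ) (F : ℝ → ℂ) : reWar (fun t => (r : ℂ) * F t) = r * reWar F := by
  rw [reWar_eq, reWar_eq, stub_scaling (r : ℂ) F, re_ofReal_mul]

/-- Scaling a test by a real constant `c`: `autocorr (c g) = c² · autocorr g`. [folklore] -/
theorem autocorr_real_mul (c : ℝ) (g : ℝ → ℂ) :
    autocorr (fun t => (c : ℂ) * g t) = fun t => ((c ^ 2 : ℝ) : ℂ) * autocorr g t := by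
  rw [autocorr_eq_weilConv, autocorr_const_mul, autocorr_eq_weilConv]
  funext t
  rw [conj_ofReal, ← ofReal_mul, sq]

/-! ## The value set -/

/-- **Normalisation.**  A Weil test `g` on the window with node-nonnegative `g ⋆ g̃` and `∫|g|² = r > 0` rescales
to an admissible `g₁ = r^{-1/2} g` with `reWar (g₁ ⋆ g̃₁) = r⁻¹ reWar (g ⋆ g̃)`. [folklore] -/
theorem exists_admissible_of_pos {g : ℝ → ℂ} (hg : IsWeilTest g) (hsupp : tsupport g ⊆ Icc (-a) a)
    (hnodes : ∀ n : ℕ, 2 ≤ n → 0 ≤ (autocorr g (Real.log n)).re) (hr : 0 < ∫ t, ‖g t‖ ^ 2) :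
    ∃ g₁ : ℝ → ℂ, IsAdmissible a g₁ ∧ reWar (autocorr g₁) = (∫ t, ‖g t‖ ^ 2)⁻¹ * reWar (autocorr g) := by
  set r : ℝ := ∫ t, ‖g t‖ ^ 2 with hrdef
  set c : ℝ := (Real.sqrt r)⁻¹ with hc
  have hc2 : c ^ 2 = r⁻¹ := by rw [hc, inv_pow, Real.sq_sqrt hr.le]
  have hauto : autocorr (fun t => (c : ℂ) * g t) = fun t => ((r⁻¹ : ℝ) : ℂ) * autocorr g t := by
    rw [autocorr_real_mul, hc2]
  refine ⟨fun t => (c : ℂ) * g t, ⟨hg.const_mul _, ?_, ?_, fun n hn => ?_⟩, ?_⟩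
  · exact (tsupport_mul_subset_right (f := fun _ : ℝ => (c : ℂ)) (g := g)).trans hsupp
  · -- `∫ |c g|² = c² ∫ |g|²` (the tree's `OddSector.integral_norm_sq_real_mul`, inlined to keep imports light)
    have e : ∫ t, ‖(c : ℂ) * g t‖ ^ 2 = c ^ 2 * ∫ t, ‖g t‖ ^ 2 := by
      simp only [norm_mul, mul_pow, Complex.norm_real, Real.norm_eq_abs, sq_abs]
      exact integral_const_mul _ _
    rw [e, hc2, ← hrdef, inv_mul_cancel₀ hr.ne']
  · rw [hauto]
    show 0 ≤ (((r⁻¹ : ℝ) : ℂ) * autocorr g (Real.log n)).re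
    rw [re_ofReal_mul]
    exact mul_nonneg (inv_nonneg.mpr hr.le) (hnodes n hn)
  · rw [hauto, reWar_const_mul]

/-- The value set is nonempty: a normalised nonnegative bump (its autocorrelation is `≥ 0` everywhere). [folklore] -/
theorem valueSet_nonempty (ha : 0 < a) : (valueSet a).Nonempty := by
  let φ : ContDiffBump (0 : ℝ) := ⟨a / 2, a, by positivity, by linarith⟩
  set g : ℝ → ℂ := fun x => ((φ x : ℝ) : ℂ) with hgdef
  have hg : IsWeilTest g :=
    ⟨Complex.ofRealCLM.contDiff.comp φ.contDiff, φ.hasCompactSupport.comp_left (g := fun r : ℝ => (r : ℂ))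
      Complex.ofReal_zero⟩
  have hsupp : tsupport g ⊆ Icc (-a) a := by
    have hs : Function.support g = Function.support (φ : ℝ → ℝ) := by ext x; simp [hgdef]
    have ht : tsupport g = tsupport (φ : ℝ → ℝ) := by simp only [tsupport, hs]
    rw [ht, φ.tsupport_eq]
    intro x hx
    rw [Metric.mem_closedBall, dist_zero_right, Real.norm_eq_abs] at hx
    exact abs_le.mp hx
  have hnodes : ∀ n : ℕ, 2 ≤ n → 0 ≤ (autocorr g (Real.log n)).re := by
    intro n _
    have e : (fun s => g s * conj (g (s - Real.log n))) = fun s => ((φ s * φ (s - Real.log n) : ℝ) : ℂ) := by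
      funext s; simp [hgdef]
    rw [autocorr_apply, e, integral_complex_ofReal, ofReal_re]
    exact integral_nonneg fun s => mul_nonneg (φ.nonneg' s) (φ.nonneg' _)
  have hr : 0 < ∫ t, ‖g t‖ ^ 2 := by
    rcases (integral_nonneg fun t => by positivity : (0 : ℝ) ≤ ∫ t, ‖g t‖ ^ 2).lt_or_eq with h | h
    · exact h
    · exfalso
      have hz := congrFun (hg.eq_zero_of_integral_norm_sq_eq_zero h.symm) 0
      simp [hgdef, φ.one_of_mem_closedBall (Metric.mem_closedBall_self (by positivity : (0 : ℝ) ≤ a / 2))] at hz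
  obtain ⟨g₁, hg₁, -⟩ := exists_admissible_of_pos hg hsupp hnodes hr
  exact ⟨_, g₁, hg₁, rfl⟩

/-- The value set is bounded below (by `ε(a) + 1`, the tree's `bddBelow_weilQuadratic_sphere_holds`, since
`Re Q(g) ≤ reWar (g ⋆ g̃)` for node-nonnegative kernels). [folklore] -/
theorem valueSet_bddBelow (a : ℝ) : BddBelow (valueSet a) := by
  obtain ⟨b, hb⟩ := bddBelow_weilQuadratic_sphere_holds a
  refine ⟨b + 1, fun x ⟨g, hg, hx⟩ => ?_⟩
  have h1 : b ≤ (weilQuadratic g).re := hb ⟨g, hg.1, hg.2.1, hg.2.2.1, rfl⟩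
  have h2 := weilQuadratic_re_le_reWar hg.1 hg.2.1 (fun n hn => by
    have := hg.2.2.2 n hn; rwa [autocorr_eq_weilConv] at this)
  rw [hx]; linarith

/-- Admissible tests have value `≥ m(a)`. [folklore] -/
theorem coneValue_le {g : ℝ → ℂ} (hg : IsAdmissible a g) : coneValue a ≤ reWar (autocorr g) + 1 :=
  csInf_le (valueSet_bddBelow a) ⟨g, hg, rfl⟩

/-! ## The key inequality on the whole sign cone (Boas–Kac) -/

/-- **`m(a) · Re F(0) ≤ reWar F + Re F(0)` for every node-nonnegative family kernel `F = Σᵢ gᵢ ⋆ g̃ᵢ` at cutoff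
`a`.**  By the Boas–Kac factorisation for smooth data (`Literature.Analysis.Fourier.BoasKac.exists_smooth_autocorr_eq_sum`)
`F = f ⋆ f̃` for ONE test `f` on the window; normalise. [folklore] -/
theorem key_ineq (ha : 0 < a) {k : ℕ} {g : Fin k → ℝ → ℂ} (hg : IsConeFamily a k g)
    (hnodes : ∀ n : ℕ, 2 ≤ n → 0 ≤ (coneSum k g (Real.log n)).re) :
    coneValue a * (coneSum k g 0).re ≤ reWar (coneSum k g) + (coneSum k g 0).re := by
  obtain ⟨f, hf, hfc, hfs, heq⟩ := Literature.Analysis.Fourier.BoasKac.exists_smooth_autocorr_eq_sum ha g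
    (fun i => (hg i).1.1) (fun i => (hg i).1.2) (fun i => (hg i).2)
  have hF : coneSum k g = autocorr f := heq.symm
  rw [hF]
  have hft : IsWeilTest f := ⟨hf, hfc⟩
  have hnodes' : ∀ n : ℕ, 2 ≤ n → 0 ≤ (autocorr f (Real.log n)).re := fun n hn => by rw [← hF]; exact hnodes n hn
  rw [autocorr_zero_re]
  rcases (integral_nonneg fun t => by positivity : (0 : ℝ) ≤ ∫ t, ‖f t‖ ^ 2).lt_or_eq with hr | hr
  · obtain ⟨g₁, hg₁, hval⟩ := exists_admissible_of_pos hft hfs hnodes' hr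
    have h := coneValue_le hg₁
    rw [hval] at h
    have h' := mul_le_mul_of_nonneg_right h hr.le
    have e : ((∫ t, ‖f t‖ ^ 2)⁻¹ * reWar (autocorr f) + 1) * ∫ t, ‖f t‖ ^ 2 = reWar (autocorr f) + ∫ t, ‖f t‖ ^ 2 := by
      field_simp
    linarith
  · have hz : f = 0 := hft.eq_zero_of_integral_norm_sq_eq_zero hr.symm
    rw [← hr, hz, autocorr_zero, reWar_zero]; simp

/-! ## A convergent minimising sequence -/

/-- **A minimising sequence of admissible tests converging in `L²`.**  There are admissible `gₙ` with
`reWar (gₙ ⋆ g̃ₙ) + 1 → m(a)` and `u ∈ L²` with `supp u ⊆ [-a, a]` and `∫ |gₙ − u|² → 0` (compactness of the Weil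
form embedding, `ConnesConsaniMoscovici2025_thm_3_6_holds`, applied to a minimising sequence: its Weil-form values
are bounded above because the prime term of a node-nonnegative kernel is `≥ 0`). [folklore] -/
theorem exists_minimising_limit : ∀ {a : ℝ}, 0 < a → ∃ (g : ℕ → ℝ → ℂ) (u : ℝ → ℂ), (∀ n, IsAdmissible a (g n)) ∧ MemLp u 2 volume ∧ Function.support u ⊆ Icc (-a) a ∧ Tendsto (fun n => ∫ x, ‖g n x - u x‖ ^ 2) atTop (𝓝 0) ∧ Tendsto (fun n => reWar (autocorr (g n)) + 1) atTop (𝓝 (coneValue a)) := by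
  intro a ha
  obtain ⟨v, hanti, hv, hmem⟩ := exists_seq_tendsto_sInf (valueSet_nonempty ha) (valueSet_bddBelow a)
  choose g hg hgv using hmem
  -- Weil-form values are bounded above along the sequence
  have hbdd : BddAbove (Set.range fun n => (weilQuadratic (g n)).re) := by
    refine ⟨v 0 - 1, ?_⟩
    rintro x ⟨n, rfl⟩
    have h1 := weilQuadratic_re_le_reWar (hg n).1 (hg n).2.1 (fun k hk => by
      have := (hg n).2.2.2 k hk; rwa [autocorr_eq_weilConv] at this)
    have h2 : v n ≤ v 0 := hanti (Nat.zero_le n)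
    linarith [hgv n]
  obtain ⟨w, hw, φ, hφ, hconv⟩ := ConnesConsaniMoscovici2025_thm_3_6_holds a ha g
    (fun n => ⟨(hg n).1, (hg n).2.1, (hg n).2.2.1⟩) hbdd
  -- cut `w` off to the window
  set u : ℝ → ℂ := (Icc (-a) a).indicator w with hu
  have humem : MemLp u 2 volume := hw.indicator measurableSet_Icc
  have hsupp_g : ∀ n, Function.support (g n) ⊆ Icc (-a) a := fun n => (subset_tsupport _).trans (hg n).2.1
  have hle : ∀ n x, ‖g (φ n) x - u x‖ ≤ ‖g (φ n) x - w x‖ := by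
    intro n x
    by_cases hx : x ∈ Icc (-a) a
    · rw [hu, indicator_of_mem hx]
    · have h0 : g (φ n) x = 0 := Function.notMem_support.mp fun h => hx (hsupp_g _ h)
      rw [hu, indicator_of_notMem hx, h0]; simp
  have hconv' : Tendsto (fun n => ∫ x, ‖g (φ n) x - u x‖ ^ 2) atTop (𝓝 0) := by
    have hg2 : ∀ n, MemLp (g n) 2 volume := fun n => (hg n).1.1.continuous.memLp_of_hasCompactSupport (hg n).1.2
    refine squeeze_zero (fun n => integral_nonneg fun x => by positivity) (fun n => ?_) hconv
    refine integral_mono ((memLp_two_iff_integrable_sq_norm ((hg2 _).sub humem).1).mp ((hg2 _).sub humem))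
      ((memLp_two_iff_integrable_sq_norm ((hg2 _).sub hw).1).mp ((hg2 _).sub hw)) fun x => ?_
    exact pow_le_pow_left₀ (norm_nonneg _) (hle n x) 2
  refine ⟨fun n => g (φ n), u, fun n => hg (φ n), humem, ?_, hconv', ?_⟩
  · intro x hx
    by_contra h
    exact hx (by rw [hu, indicator_of_notMem h])
  · have : Tendsto (fun n => v (φ n)) atTop (𝓝 (coneValue a)) := hv.comp hφ.tendsto_atTop
    exact this.congr fun n => hgv (φ n)

end Summit.RiemannHypothesis.RiemannHypothesis.Theorems.SignCone.DualWitness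

end
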